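import Summits.ResolutionOfSingularities.ResolutionOfSingularities.Theorems.FrobeniusLadderFInjectiveMacaulayficationProp44T1FullGlue
import HarnessLib
/-!
# Cossart–Piltant 2008, Prop. 4.4 — the T1 line under the FULL-CHAIN ring contract: the point-step cases «opposite vertex» and «non-rational»

OURS (res-inputs-p-8b g2). Contract v3 clauses `hopp` (the near point is the origin of the `w`-chart; generator conversion by a unit) and
`hnonrat` (non-rational near point; σ′'s block with the residue-field generation clause). AI-written; AI review weaker than expert review. `CossartPiltant2008_prop44`, T1 and the ring contract are NOT proved here;
resolution in dimension `≥ 4` / positive characteristic is NOT proved. No definitions, no named facts.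
-/
noncomputable section

open CategoryTheory CategoryTheory.Limits AlgebraicGeometry TopologicalSpace IsLocalRing MvPolynomial
open Literature.AlgebraicGeometry.Resolution Scheme.IdealSheafData

namespace Summit.ResolutionOfSingularities.ResolutionOfSingularities.Theorems

namespace CP2008Prop44

universe u
set_option maxHeartbeats 800000 in
/-- **Point step, case «opposite vertex `(0 : 1)`»** (clause `hopp`): σ′'s `u₂`-chart block, with the generator `φ w` of the exceptional ideal
replaced by the scheme-supplied `u_{n+1}` (they differ by a unit). [cite: CossartPiltant2008, Lemma 4.3 (5); Lemma 4.5 (2)] -/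
theorem fullChain_hopp (Xs : ℕ → Scheme.{u})
    (hN : ∀ n, IsLocallyNoetherian (Xs n)) (hXreg : ∀ n, Scheme.IsRegular (Xs n))
    (π : ∀ n, Xs (n + 1) ⟶ Xs n) (Y : ∀ n, Closeds (Xs n)) (y : ∀ n, Xs (n + 1))
    (J : ∀ n, (Xs n).IdealSheafData) {μ : ℕ} (hμ : 1 ≤ μ)
    (hy : ∀ n, π (n + 1) (y (n + 1)) = y n)
    (hmem : ∀ n, π n (y n) ∈ (Y n : Set (Xs n)))
    (hcl : ∀ n, IsClosed ({π n (y n)} : Set (Xs n)))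
    (hYirr : ∀ n, IsIrreducible ((Y n : Closeds (Xs n)) : Set (Xs n)))
    (hYreg : ∀ n, Scheme.IsRegular (vanishingIdeal (Y n)).subscheme)
    (hYord : ∀ n, ∀ z ∈ (Y n : Set (Xs n)), idealOrder (J n) z = μ)
    (hπ : ∀ n, IsBlowup (π n) (vanishingIdeal (Y n)))
    (hJ : ∀ n, J (n + 1) = controlledTransform (π n) (vanishingIdeal (Y n)) (J n) μ)
    (hbd : ∀ n (z : Xs n), idealOrder (J n) z ≤ μ)
    (hcodim : ∀ n, ∀ z ∈ (J n).support, 1 < Order.coheight z)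
    (hd : ∀ n, (maximalIdeal ((Xs n).presheaf.stalk (π n (y n)))).spanFinrank = 3)
    (hnear : ∀ n, IsNear (π n) (vanishingIdeal (Y n)) (J n) μ (y n))
    (hτ : ∀ n, @stalkTau (Xs n) (J n) (π n (y n)) (hXreg n (π n (y n))) μ = 1)
    (hG : ∀ n, IsGRing ((Xs n).presheaf.stalk (π n (y n))))
    (hcoinc : ∀ n (z : Xs n), z ⤳ π n (y n) → idealOrder (J n) z = μ → z ∈ (Y n : Set (Xs n)))
    (n : ℕ) (hptn : (Y n : Set (Xs n)) = {π n (y n)}) (un : chainRing Xs π y n) (u' : chainRing Xs π y (n + 1))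
    (hEm : (maximalIdeal (chainRing Xs π y n)).map (chainMap Xs π y hy n) = Ideal.span {u'})
    (hu_ratn : Ideal.span {chainMap Xs π y hy n un} = Ideal.span {u'} → u' = chainMap Xs π y hy n un)
    (yv wv : chainRing Xs π y n) (hgen : Ideal.span {yv, un, wv} = maximalIdeal _)
    (had : ∀ G ∈ initialForms ![yv, un, wv] (chainIdeal Xs π y J n) μ, ∃ a : ResidueField (chainRing Xs π y n), G = C a * X 0 ^ μ)
    (hne : Ideal.span {chainMap Xs π y hy n un} ≠ Ideal.span {u'}) :
    Function.Surjective (ResidueField.map (chainMap Xs π y hy n)) ∧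
      ∃ (y' v' : chainRing Xs π y (n + 1)), chainMap Xs π y hy n yv = u' * y' ∧ chainMap Xs π y hy n un = u' * v' ∧
        Ideal.span {y', v', u'} = maximalIdeal (chainRing Xs π y (n + 1)) := by
  classical
  haveI := hN
  haveI hR : ∀ n, IsRegularLocalRing (chainRing Xs π y n) := fun n => hXreg n _
  haveI hDom : ∀ n, IsDomain (chainRing Xs π y n) := fun n => isDomain_of_isRegularLocalRing _
  have _h := hG; have _h := hbd; have _h := hmem; have _h := hYirr; have _h := hcodim; have _h := hcoinc; have _h := hYreg; have _h := hYord; have _h := hJ; have _h := hu_ratn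
  have rangeFin3 : ∀ {α : Type u} (c : Fin 3 → α), Set.range c = {c 0, c 1, c 2} := by
    intro α c
    ext a
    simp only [Set.mem_range, Set.mem_insert_iff, Set.mem_singleton_iff]
    constructor
    · rintro ⟨i, rfl⟩
      fin_cases i
      · exact Or.inl rfl
      · exact Or.inr (Or.inl rfl)
      · exact Or.inr (Or.inr rfl)
    · rintro (h | h | h) <;> exact ⟨_, h.symm⟩
  have range3 : ∀ {α : Type u} (a b c : α), Set.range ![a, b, c] = {a, b, c} := by
    intro α a b c
    rw [rangeFin3]; rfl
  have range2 : ∀ {α : Type u} (a b : α), Set.range ![a, b] = {a, b} := by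
    intro α a b; ext t
    simp only [Set.mem_range, Set.mem_insert_iff, Set.mem_singleton_iff]
    constructor
    · rintro ⟨i, rfl⟩
      fin_cases i
      · exact Or.inl rfl
      · exact Or.inr rfl
    · rintro (h | h)
      · exact ⟨0, by simp [h]⟩
      · exact ⟨1, by simp [h]⟩
  have range1 : ∀ {α : Type u} (a : α), Set.range ![a] = {a} := fun a => by ext s; simp [eq_comm]
  have _r3 := @range3; have _r2 := @range2; have _r1 := @range1
  have hdim : ∀ n, ringKrullDim (chainRing Xs π y n) = 3 := by
    intro n
    have h := (isRegularLocalRing_iff (chainRing Xs π y n)).mp inferInstance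
    rw [hd n] at h
    exact_mod_cast h.symm
  have hτr : ∀ n (c : Fin 3 → chainRing Xs π y n), Ideal.span (Set.range c) = maximalIdeal _ →
      hironakaTauAt c (chainIdeal Xs π y J n) μ = 1 := by
    intro n c hc
    rw [chainIdeal, ← stalkTau_eq (J n) (π n (y n)) μ (hd n) c hc]
    exact hτ n
  have hpt_P : ∀ n, (Y n : Set (Xs n)) = {π n (y n)} → stalkIdeal (vanishingIdeal (Y n)) (π n (y n)) = maximalIdeal _ := by
    intro n hn
    have hYn : Y n = ⟨{π n (y n)}, hcl n⟩ := Closeds.ext hn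
    rw [hYn, stalkIdeal_vanishingIdeal_singleton (hcl n)]
  have hcM : chainMap Xs π y hy n = stalkMapCongr (π n) (y n) (π (n + 1) (y (n + 1))) (hy n) := rfl
  show Function.Surjective (ResidueField.map (chainMap Xs π y hy n)) ∧
    ∃ (y' v' : chainRing Xs π y (n + 1)), chainMap Xs π y hy n yv = u' * y' ∧ chainMap Xs π y hy n un = u' * v' ∧
      Ideal.span {y', v', u'} = maximalIdeal (chainRing Xs π y (n + 1))
  set c : Fin 3 → chainRing Xs π y n := ![yv, un, wv] with hc_def
  have hc3 : Ideal.span {c 0, c 1, c 2} = maximalIdeal _ := hgen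
  have hc : Ideal.span (Set.range c) = maximalIdeal _ := by rw [hc_def, range3]; exact hgen
  have hcY : Ideal.span (Set.range c) = stalkIdeal (vanishingIdeal (Y n)) (π n (y n)) := by rw [hc, hpt_P _ hptn]
  have hadI : ∀ i, i ≠ 0 → IsAdapted c (chainIdeal Xs π y J n) μ i := bridge_isAdapted had
  rcases sigma'_congr (hπ n) hμ (hd n) hc hcY (hτ n) hadI (hnear n) (π (n + 1) (y (n + 1))) (hy n) (hd (n + 1)) with
    ⟨a, c', h1, h0, h2, hgen', hsurj, -⟩ | ⟨t, Pq, c', h1, h0, ht, hmon, hP, hdeg, hirr, hres, hgen', -, hκ⟩ |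
    ⟨c', h2, h0, h1, hgen', hsurj, -⟩
  · exfalso
    have hmap1 : (maximalIdeal (chainRing Xs π y n)).map (chainMap Xs π y hy n) = Ideal.span {chainMap Xs π y hy n un} := by
      rw [hcM]
      refine map_maximalIdeal_eq_span_of_chart _ hc3 1 (fun i => ?_)
      fin_cases i
      · simp only [hc_def, Fin.zero_eta, Matrix.cons_val_zero, Matrix.cons_val_one]
        rw [show (stalkMapCongr (π n) (y n) (π (n + 1) (y (n + 1))) (hy n)) yv = _ * c' 0 by simpa [hc_def] using h0]
        exact Ideal.mul_mem_right _ _ (Ideal.mem_span_singleton_self _)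
      · exact Ideal.mem_span_singleton_self _
      · simp only [hc_def, Fin.reduceFinMk, Matrix.cons_val, Matrix.cons_val_one]
        have e : (stalkMapCongr (π n) (y n) (π (n + 1) (y (n + 1))) (hy n)) wv =
            (stalkMapCongr (π n) (y n) (π (n + 1) (y (n + 1))) (hy n)) (wv - a * un) +
              (stalkMapCongr (π n) (y n) (π (n + 1) (y (n + 1))) (hy n)) a *
                (stalkMapCongr (π n) (y n) (π (n + 1) (y (n + 1))) (hy n)) un := by
          rw [map_sub, map_mul]; ring
        rw [e, show (stalkMapCongr (π n) (y n) (π (n + 1) (y (n + 1))) (hy n)) (wv - a * un) = _ * c' 2 by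
          simpa [hc_def] using h2]
        exact Ideal.add_mem _ (Ideal.mul_mem_right _ _ (Ideal.mem_span_singleton_self _))
          (Ideal.mul_mem_left _ _ (Ideal.mem_span_singleton_self _))
    exact hne (hmap1.symm.trans hEm)
  · exfalso
    have hmap1 : (maximalIdeal (chainRing Xs π y n)).map (chainMap Xs π y hy n) = Ideal.span {chainMap Xs π y hy n un} := by
      rw [hcM]
      refine map_maximalIdeal_eq_span_of_chart _ hc3 1 (fun i => ?_)
      fin_cases i
      · simp only [hc_def, Fin.zero_eta, Matrix.cons_val_zero, Matrix.cons_val_one]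
        rw [show (stalkMapCongr (π n) (y n) (π (n + 1) (y (n + 1))) (hy n)) yv = _ * c' 0 by simpa [hc_def] using h0]
        exact Ideal.mul_mem_right _ _ (Ideal.mem_span_singleton_self _)
      · exact Ideal.mem_span_singleton_self _
      · simp only [hc_def, Fin.reduceFinMk, Matrix.cons_val, Matrix.cons_val_one]
        rw [show (stalkMapCongr (π n) (y n) (π (n + 1) (y (n + 1))) (hy n)) wv = _ * t by simpa [hc_def] using ht]
        exact Ideal.mul_mem_right _ _ (Ideal.mem_span_singleton_self _)
    exact hne (hmap1.symm.trans hEm)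
  · -- the opposite vertex: generator `φ w`, `u (n+1) = φ w · e`
    have hmap2 : (maximalIdeal (chainRing Xs π y n)).map (chainMap Xs π y hy n) = Ideal.span {chainMap Xs π y hy n wv} := by
      rw [hcM]
      refine map_maximalIdeal_eq_span_of_chart _ hc3 2 (fun i => ?_)
      fin_cases i
      · simp only [hc_def, Fin.zero_eta, Matrix.cons_val_zero, Matrix.cons_val]
        rw [show (stalkMapCongr (π n) (y n) (π (n + 1) (y (n + 1))) (hy n)) yv = _ * c' 0 by simpa [hc_def] using h0]
        exact Ideal.mul_mem_right _ _ (Ideal.mem_span_singleton_self _)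
      · simp only [hc_def, Fin.mk_one, Matrix.cons_val_one, Matrix.cons_val]
        rw [show (stalkMapCongr (π n) (y n) (π (n + 1) (y (n + 1))) (hy n)) un = _ * c' 1 by simpa [hc_def] using h1]
        exact Ideal.mul_mem_right _ _ (Ideal.mem_span_singleton_self _)
      · exact Ideal.mem_span_singleton_self _
    obtain ⟨e, he⟩ := exists_unit_mul_eq_of_span_singleton_eq (hmap2.symm.trans hEm)
    have hwe : chainMap Xs π y hy n wv = u' * ↑e⁻¹ := by rw [← he, mul_assoc, Units.mul_inv, mul_one]
    have h0' : chainMap Xs π y hy n yv = chainMap Xs π y hy n wv * c' 0 := by rw [hcM]; simpa [hc_def] using h0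
    have h1' : chainMap Xs π y hy n un = chainMap Xs π y hy n wv * c' 1 := by rw [hcM]; simpa [hc_def] using h1
    have h2' : c' 2 = chainMap Xs π y hy n wv := by rw [hcM]; simpa [hc_def] using h2
    refine ⟨hsurj, ↑e⁻¹ * c' 0, ↑e⁻¹ * c' 1, by rw [h0', hwe]; ring, by rw [h1', hwe]; ring, ?_⟩
    rw [← hgen']
    apply le_antisymm
    · rw [Ideal.span_le]
      rintro t ht
      simp only [Set.mem_insert_iff, Set.mem_singleton_iff] at ht
      rcases ht with rfl | rfl | rfl
      · exact Ideal.mul_mem_left _ _ (Ideal.subset_span (by simp))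
      · exact Ideal.mul_mem_left _ _ (Ideal.subset_span (by simp))
      · rw [← he, ← h2']; exact Ideal.mul_mem_right _ _ (Ideal.subset_span (by simp))
    · rw [Ideal.span_le]
      rintro t ht
      simp only [Set.mem_insert_iff, Set.mem_singleton_iff] at ht
      rcases ht with rfl | rfl | rfl
      · have : c' 0 = ↑e * (↑e⁻¹ * c' 0) := by rw [← mul_assoc, Units.mul_inv, one_mul]
        rw [this]; exact Ideal.mul_mem_left _ _ (Ideal.subset_span (by simp))
      · have : c' 1 = ↑e * (↑e⁻¹ * c' 1) := by rw [← mul_assoc, Units.mul_inv, one_mul]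
        rw [this]; exact Ideal.mul_mem_left _ _ (Ideal.subset_span (by simp))
      · rw [h2', hwe]; exact Ideal.mul_mem_right _ _ (Ideal.subset_span (by simp))

set_option maxHeartbeats 800000 in
/-- **Point step, case «non-rational»** (clause `hnonrat`): σ′'s non-rational block with the residue-field generation clause `hκ`.
[cite: CossartPiltant2008, Lemma 4.3 (5); Lemma 4.5 (2), pp. 12–14] -/
theorem fullChain_hnonrat (Xs : ℕ → Scheme.{u})
    (hN : ∀ n, IsLocallyNoetherian (Xs n)) (hXreg : ∀ n, Scheme.IsRegular (Xs n))
    (π : ∀ n, Xs (n + 1) ⟶ Xs n) (Y : ∀ n, Closeds (Xs n)) (y : ∀ n, Xs (n + 1))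
    (J : ∀ n, (Xs n).IdealSheafData) {μ : ℕ} (hμ : 1 ≤ μ)
    (hy : ∀ n, π (n + 1) (y (n + 1)) = y n)
    (hmem : ∀ n, π n (y n) ∈ (Y n : Set (Xs n)))
    (hcl : ∀ n, IsClosed ({π n (y n)} : Set (Xs n)))
    (hYirr : ∀ n, IsIrreducible ((Y n : Closeds (Xs n)) : Set (Xs n)))
    (hYreg : ∀ n, Scheme.IsRegular (vanishingIdeal (Y n)).subscheme)
    (hYord : ∀ n, ∀ z ∈ (Y n : Set (Xs n)), idealOrder (J n) z = μ)
    (hπ : ∀ n, IsBlowup (π n) (vanishingIdeal (Y n)))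
    (hJ : ∀ n, J (n + 1) = controlledTransform (π n) (vanishingIdeal (Y n)) (J n) μ)
    (hbd : ∀ n (z : Xs n), idealOrder (J n) z ≤ μ)
    (hcodim : ∀ n, ∀ z ∈ (J n).support, 1 < Order.coheight z)
    (hd : ∀ n, (maximalIdeal ((Xs n).presheaf.stalk (π n (y n)))).spanFinrank = 3)
    (hnear : ∀ n, IsNear (π n) (vanishingIdeal (Y n)) (J n) μ (y n))
    (hτ : ∀ n, @stalkTau (Xs n) (J n) (π n (y n)) (hXreg n (π n (y n))) μ = 1)
    (hG : ∀ n, IsGRing ((Xs n).presheaf.stalk (π n (y n))))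
    (hcoinc : ∀ n (z : Xs n), z ⤳ π n (y n) → idealOrder (J n) z = μ → z ∈ (Y n : Set (Xs n)))
    (n : ℕ) (hptn : (Y n : Set (Xs n)) = {π n (y n)}) (un : chainRing Xs π y n) (u' : chainRing Xs π y (n + 1))
    (hEm : (maximalIdeal (chainRing Xs π y n)).map (chainMap Xs π y hy n) = Ideal.span {u'})
    (hu_ratn : Ideal.span {chainMap Xs π y hy n un} = Ideal.span {u'} → u' = chainMap Xs π y hy n un)
    (yv wv : chainRing Xs π y n) (hgen : Ideal.span {yv, un, wv} = maximalIdeal _)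
    (had : ∀ G ∈ initialForms ![yv, un, wv] (chainIdeal Xs π y J n) μ, ∃ a : ResidueField (chainRing Xs π y n), G = C a * X 0 ^ μ)
    (hns : ¬ Function.Surjective (ResidueField.map (chainMap Xs π y hy n))) :
    u' = chainMap Xs π y hy n un ∧
      ∃ (t : chainRing Xs π y (n + 1)) (Q : Polynomial (chainRing Xs π y n)) (y' : chainRing Xs π y (n + 1)),
        chainMap Xs π y hy n yv = chainMap Xs π y hy n un * y' ∧ chainMap Xs π y hy n wv = chainMap Xs π y hy n un * t ∧
        Q.Monic ∧ 2 ≤ (Q.map (residue (chainRing Xs π y n))).natDegree ∧ Irreducible (Q.map (residue (chainRing Xs π y n))) ∧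
        (∀ G : Polynomial (chainRing Xs π y n), Polynomial.eval₂ (chainMap Xs π y hy n) t G ∈ maximalIdeal (chainRing Xs π y (n + 1)) ↔
          Q.map (residue (chainRing Xs π y n)) ∣ G.map (residue (chainRing Xs π y n))) ∧
        (∀ r : ResidueField (chainRing Xs π y (n + 1)), ∃ G : Polynomial (chainRing Xs π y n),
          residue (chainRing Xs π y (n + 1)) (Polynomial.eval₂ (chainMap Xs π y hy n) t G) = r) ∧
        Ideal.span {y', chainMap Xs π y hy n un, Polynomial.eval₂ (chainMap Xs π y hy n) t Q} = maximalIdeal (chainRing Xs π y (n + 1)) := by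
  classical
  haveI := hN
  haveI hR : ∀ n, IsRegularLocalRing (chainRing Xs π y n) := fun n => hXreg n _
  haveI hDom : ∀ n, IsDomain (chainRing Xs π y n) := fun n => isDomain_of_isRegularLocalRing _
  have _h := hG; have _h := hbd; have _h := hmem; have _h := hYirr; have _h := hcodim; have _h := hcoinc; have _h := hYreg; have _h := hYord; have _h := hJ; have _h := hu_ratn
  have rangeFin3 : ∀ {α : Type u} (c : Fin 3 → α), Set.range c = {c 0, c 1, c 2} := by
    intro α c
    ext a
    simp only [Set.mem_range, Set.mem_insert_iff, Set.mem_singleton_iff]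
    constructor
    · rintro ⟨i, rfl⟩
      fin_cases i
      · exact Or.inl rfl
      · exact Or.inr (Or.inl rfl)
      · exact Or.inr (Or.inr rfl)
    · rintro (h | h | h) <;> exact ⟨_, h.symm⟩
  have range3 : ∀ {α : Type u} (a b c : α), Set.range ![a, b, c] = {a, b, c} := by
    intro α a b c
    rw [rangeFin3]; rfl
  have range2 : ∀ {α : Type u} (a b : α), Set.range ![a, b] = {a, b} := by
    intro α a b; ext t
    simp only [Set.mem_range, Set.mem_insert_iff, Set.mem_singleton_iff]
    constructor
    · rintro ⟨i, rfl⟩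
      fin_cases i
      · exact Or.inl rfl
      · exact Or.inr rfl
    · rintro (h | h)
      · exact ⟨0, by simp [h]⟩
      · exact ⟨1, by simp [h]⟩
  have range1 : ∀ {α : Type u} (a : α), Set.range ![a] = {a} := fun a => by ext s; simp [eq_comm]
  have _r3 := @range3; have _r2 := @range2; have _r1 := @range1
  have hdim : ∀ n, ringKrullDim (chainRing Xs π y n) = 3 := by
    intro n
    have h := (isRegularLocalRing_iff (chainRing Xs π y n)).mp inferInstance
    rw [hd n] at h
    exact_mod_cast h.symm
  have hτr : ∀ n (c : Fin 3 → chainRing Xs π y n), Ideal.span (Set.range c) = maximalIdeal _ →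
      hironakaTauAt c (chainIdeal Xs π y J n) μ = 1 := by
    intro n c hc
    rw [chainIdeal, ← stalkTau_eq (J n) (π n (y n)) μ (hd n) c hc]
    exact hτ n
  have hpt_P : ∀ n, (Y n : Set (Xs n)) = {π n (y n)} → stalkIdeal (vanishingIdeal (Y n)) (π n (y n)) = maximalIdeal _ := by
    intro n hn
    have hYn : Y n = ⟨{π n (y n)}, hcl n⟩ := Closeds.ext hn
    rw [hYn, stalkIdeal_vanishingIdeal_singleton (hcl n)]
  have hcM : chainMap Xs π y hy n = stalkMapCongr (π n) (y n) (π (n + 1) (y (n + 1))) (hy n) := rfl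
  show u' = chainMap Xs π y hy n un ∧
    ∃ (t : chainRing Xs π y (n + 1)) (Q : Polynomial (chainRing Xs π y n)) (y' : chainRing Xs π y (n + 1)),
      chainMap Xs π y hy n yv = chainMap Xs π y hy n un * y' ∧ chainMap Xs π y hy n wv = chainMap Xs π y hy n un * t ∧
      Q.Monic ∧ 2 ≤ (Q.map (residue (chainRing Xs π y n))).natDegree ∧ Irreducible (Q.map (residue (chainRing Xs π y n))) ∧
      (∀ G : Polynomial (chainRing Xs π y n), Polynomial.eval₂ (chainMap Xs π y hy n) t G ∈ maximalIdeal (chainRing Xs π y (n + 1)) ↔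
        Q.map (residue (chainRing Xs π y n)) ∣ G.map (residue (chainRing Xs π y n))) ∧
      (∀ r : ResidueField (chainRing Xs π y (n + 1)), ∃ G : Polynomial (chainRing Xs π y n),
        residue (chainRing Xs π y (n + 1)) (Polynomial.eval₂ (chainMap Xs π y hy n) t G) = r) ∧
      Ideal.span {y', chainMap Xs π y hy n un, Polynomial.eval₂ (chainMap Xs π y hy n) t Q} = maximalIdeal (chainRing Xs π y (n + 1))
  set c : Fin 3 → chainRing Xs π y n := ![yv, un, wv] with hc_def
  have hc3 : Ideal.span {c 0, c 1, c 2} = maximalIdeal _ := hgen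
  have hc : Ideal.span (Set.range c) = maximalIdeal _ := by rw [hc_def, range3]; exact hgen
  have hcY : Ideal.span (Set.range c) = stalkIdeal (vanishingIdeal (Y n)) (π n (y n)) := by rw [hc, hpt_P _ hptn]
  have hadI : ∀ i, i ≠ 0 → IsAdapted c (chainIdeal Xs π y J n) μ i := bridge_isAdapted had
  rcases sigma'_congr (hπ n) hμ (hd n) hc hcY (hτ n) hadI (hnear n) (π (n + 1) (y (n + 1))) (hy n) (hd (n + 1)) with
    ⟨a, c', h1, h0, h2, hgen', hsurj, -⟩ | ⟨t, Pq, c', h1, h0, ht, hmon, hP, hdeg, hirr, hres, hgen', -, hκ⟩ |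
    ⟨c', h2, h0, h1, hgen', hsurj, -⟩
  · exact absurd hsurj hns
  · -- the non-rational block
    have hmap1 : (maximalIdeal (chainRing Xs π y n)).map (chainMap Xs π y hy n) = Ideal.span {chainMap Xs π y hy n un} := by
      rw [hcM]
      refine map_maximalIdeal_eq_span_of_chart _ hc3 1 (fun i => ?_)
      fin_cases i
      · simp only [hc_def, Fin.zero_eta, Matrix.cons_val_zero, Matrix.cons_val_one]
        rw [show (stalkMapCongr (π n) (y n) (π (n + 1) (y (n + 1))) (hy n)) yv = _ * c' 0 by simpa [hc_def] using h0]
        exact Ideal.mul_mem_right _ _ (Ideal.mem_span_singleton_self _)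
      · exact Ideal.mem_span_singleton_self _
      · simp only [hc_def, Fin.reduceFinMk, Matrix.cons_val, Matrix.cons_val_one]
        rw [show (stalkMapCongr (π n) (y n) (π (n + 1) (y (n + 1))) (hy n)) wv = _ * t by simpa [hc_def] using ht]
        exact Ideal.mul_mem_right _ _ (Ideal.mem_span_singleton_self _)
    have hun : u' = chainMap Xs π y hy n un := hu_ratn (by rw [← hmap1, hEm])
    refine ⟨hun, t, Pq, c' 0, ?_, ?_, hmon, hdeg, hirr, ?_, ?_, ?_⟩
    · rw [hcM]; simpa [hc_def] using h0
    · rw [hcM]; simpa [hc_def] using ht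
    · rw [hcM]; exact hres
    · rw [hcM]; exact hκ
    · rw [h1, hP] at hgen'
      rw [hcM]
      simp only [hc_def, Matrix.cons_val_one, Matrix.cons_val_zero] at hgen'
      convert hgen' using 2
  · exact absurd hsurj hns

set_option maxHeartbeats 800000 in
/-- **After a curve step the next curve centre is the corrected strict transform** (contract clause `hPsucc_cv`): κ (p624926) names the chart,
κ″ (p626243) gives `u_{n+1} ∈ P_{n+1}` and `β ∈ 𝔪_n` with `(y′ + φβ, u_{n+1}) = P_{n+1}`. [cite: CossartPiltant2008, Prop. 4.4 (proof, p. 11); Lemma 4.5 (2)] -/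
theorem fullChain_hPsucc_cv (Xs : ℕ → Scheme.{u})
    (hN : ∀ n, IsLocallyNoetherian (Xs n)) (hXreg : ∀ n, Scheme.IsRegular (Xs n))
    (π : ∀ n, Xs (n + 1) ⟶ Xs n) (Y : ∀ n, Closeds (Xs n)) (y : ∀ n, Xs (n + 1))
    (J : ∀ n, (Xs n).IdealSheafData) {μ : ℕ} (hμ : 1 ≤ μ)
    (hy : ∀ n, π (n + 1) (y (n + 1)) = y n)
    (hmem : ∀ n, π n (y n) ∈ (Y n : Set (Xs n)))
    (hcl : ∀ n, IsClosed ({π n (y n)} : Set (Xs n)))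
    (hYirr : ∀ n, IsIrreducible ((Y n : Closeds (Xs n)) : Set (Xs n)))
    (hYreg : ∀ n, Scheme.IsRegular (vanishingIdeal (Y n)).subscheme)
    (hYord : ∀ n, ∀ z ∈ (Y n : Set (Xs n)), idealOrder (J n) z = μ)
    (hπ : ∀ n, IsBlowup (π n) (vanishingIdeal (Y n)))
    (hJ : ∀ n, J (n + 1) = controlledTransform (π n) (vanishingIdeal (Y n)) (J n) μ)
    (hbd : ∀ n (z : Xs n), idealOrder (J n) z ≤ μ)
    (hcodim : ∀ n, ∀ z ∈ (J n).support, 1 < Order.coheight z)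
    (hd : ∀ n, (maximalIdeal ((Xs n).presheaf.stalk (π n (y n)))).spanFinrank = 3)
    (hnear : ∀ n, IsNear (π n) (vanishingIdeal (Y n)) (J n) μ (y n))
    (hτ : ∀ n, @stalkTau (Xs n) (J n) (π n (y n)) (hXreg n (π n (y n))) μ = 1)
    (hG : ∀ n, IsGRing ((Xs n).presheaf.stalk (π n (y n))))
    (hcoinc : ∀ n (z : Xs n), z ⤳ π n (y n) → idealOrder (J n) z = μ → z ∈ (Y n : Set (Xs n)))
    (n : ℕ) (hnpt : (Y n : Set (Xs n)) ≠ {π n (y n)}) (hnpt1 : (Y (n + 1) : Set (Xs (n + 1))) ≠ {π (n + 1) (y (n + 1))})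
    (un : chainRing Xs π y n) (u' : chainRing Xs π y (n + 1))
    (hEc : (stalkIdeal (vanishingIdeal (Y n)) (π n (y n))).map (chainMap Xs π y hy n) = Ideal.span {u'})
    (hu_ratn : Ideal.span {chainMap Xs π y hy n un} = Ideal.span {u'} → u' = chainMap Xs π y hy n un)
    (yv wv : chainRing Xs π y n) (y' : chainRing Xs π y (n + 1))
    (hyu : Ideal.span {yv, un} = stalkIdeal (vanishingIdeal (Y n)) (π n (y n)))
    (hgen : Ideal.span {yv, un, wv} = maximalIdeal _)
    (had : ∀ G ∈ initialForms ![yv, un, wv] (chainIdeal Xs π y J n) μ, ∃ a : ResidueField (chainRing Xs π y n), G = C a * X 0 ^ μ)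
    (hrel : chainMap Xs π y hy n yv = chainMap Xs π y hy n un * y') :
    u' ∈ stalkIdeal (vanishingIdeal (Y (n + 1))) (π (n + 1) (y (n + 1))) ∧
      ∃ β ∈ maximalIdeal (chainRing Xs π y n),
        Ideal.span {y' + chainMap Xs π y hy n β, u'} = stalkIdeal (vanishingIdeal (Y (n + 1))) (π (n + 1) (y (n + 1))) := by
  classical
  haveI := hN
  haveI hR : ∀ n, IsRegularLocalRing (chainRing Xs π y n) := fun n => hXreg n _
  haveI hDom : ∀ n, IsDomain (chainRing Xs π y n) := fun n => isDomain_of_isRegularLocalRing _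
  have _a := hbd; have _b := hnear; have _c := hG
  have range3 : ∀ {α : Type u} (a b c : α), Set.range ![a, b, c] = {a, b, c} := by
    intro α a b c
    ext t
    simp only [Set.mem_range, Set.mem_insert_iff, Set.mem_singleton_iff]
    constructor
    · rintro ⟨i, rfl⟩
      fin_cases i
      · exact Or.inl rfl
      · exact Or.inr (Or.inl rfl)
      · exact Or.inr (Or.inr rfl)
    · rintro (h | h | h)
      · exact ⟨0, by simp [h]⟩
      · exact ⟨1, by simp [h]⟩
      · exact ⟨2, by simp [h]⟩
  have hcM : chainMap Xs π y hy n = stalkMapCongr (π n) (y n) (π (n + 1) (y (n + 1))) (hy n) := rfl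
  obtain ⟨hπζ, hζnear, hYζ, hcohη, hcohζ⟩ :=
    tauOneChain_curveStep_succ Xs hN hXreg π Y y J hμ hy hmem hcl hYirr hYreg hYord hπ hJ hcodim hd hcoinc n hnpt hnpt1
  obtain ⟨hYη, -, -, -, -, -⟩ :=
    genericPoint_curve_facts (hXreg n) hμ (hcodim n) (hYirr n) (hYord n) (hmem n) (hcl n) (hd n) hnpt
  have hζq : (hYirr (n + 1)).genericPoint ⤳ π (n + 1) (y (n + 1)) :=
    specializes_iff_mem_closure.mpr (hYζ ▸ hmem (n + 1))
  have hYη' : (Y n : Set (Xs n)) = closure {π n (hYirr (n + 1)).genericPoint} := by rw [hπζ]; exact hYη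
  have hcohη' : Order.coheight (π n (hYirr (n + 1)).genericPoint) = 2 := by rw [hπζ]; exact hcohη
  set c : Fin 3 → chainRing Xs π y n := ![yv, un, wv] with hc_def
  have hc : Ideal.span (Set.range c) = maximalIdeal _ := by rw [hc_def, range3]; exact hgen
  have hcY : Ideal.span {c 0, c 1} = stalkIdeal (vanishingIdeal (Y n)) (π n (y n)) := by
    simp only [hc_def, Matrix.cons_val_zero, Matrix.cons_val_one]; exact hyu
  have hadI : ∀ i, i ≠ 0 → IsAdapted c (chainIdeal Xs π y J n) μ i := bridge_isAdapted had
  obtain ⟨c', hmapY, h1, h0, h2, hgen', -, -⟩ :=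
    IsBlowup.exists_curveStepData_of_adapted_congr (hXreg n) (hYreg n) (hπ n) hμ (hYord n) (hd n)
      hc hcY (hτ n) hadI (hnear n) (π (n + 1) (y (n + 1))) (hy n)
  simp only [hc_def, Matrix.cons_val_one, Matrix.cons_val_zero, Matrix.cons_val_two, Matrix.tail_cons, Matrix.head_cons] at h1 h0 h2 hmapY
  have hun : u' = chainMap Xs π y hy n un := by
    apply hu_ratn
    rw [← hEc, hcM]; exact hmapY.symm
  have hφu : chainMap Xs π y hy n un ≠ 0 := by
    intro h0'
    rw [h1, ← hcM, h0', Set.insert_comm (c' 0) 0, Ideal.span, Submodule.span_insert_zero] at hgen'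
    exact false_of_span_pair_eq_maximalIdeal hgen' (hd (n + 1))
  have h0c : chainMap Xs π y hy n yv = chainMap Xs π y hy n un * c' 0 := by rw [hcM]; exact h0
  have hy' : y' = c' 0 := mul_left_cancel₀ hφu (hrel.symm.trans h0c)
  rw [h1, h2, ← hy'] at hgen'
  have hrel' : stalkMapCongr (π n) (y n) (π (n + 1) (y (n + 1))) (hy n) yv =
      stalkMapCongr (π n) (y n) (π (n + 1) (y (n + 1))) (hy n) un * y' := by
    rw [← hcM]; exact hrel
  obtain ⟨hmemu, β, hβ, hspan⟩ :=
    curveStep_succ_centre_congr (hXreg n) (hYreg n) (hπ n) hμ (hYord n) (π (n + 1) (y (n + 1)))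
      (hy n) (hd n) (hd (n + 1)) hζq hcohζ hcohη' hYη' hζnear (Y' := Y (n + 1)) hYζ hgen hyu hrel' hgen'
  rw [hun, hcM]
  exact ⟨hmemu, β, hβ, hspan⟩

end CP2008Prop44

end Summit.ResolutionOfSingularities.ResolutionOfSingularities.Theorems

end
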